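import Mathlib.Analysis.SpecialFunctions.Pow.Real

/-!
# Route EIHFluxBalance — `ModulatedKerrHandoff`, stub `stub_oneHoleMatching`: real arithmetic of the tame regime

Helper file for the crux `stmt-FinalStateConjecture-10167`
(`Summit.FinalStateConjecture.FinalStateConjecture.Theses.EIHFluxBalance.ModulatedKerrHandoff`),
line `photon-rocket-modulation`, stub `stub_oneHoleMatching` (one-hole profile matching).

Pure real-arithmetic lemmas isolating the bookkeeping of the tame regime (lab time `t ≥ 1`, retarded
time `c t ≤ U ≤ t`, retardation `Δ ≤ d/(1 − v)`, lab distance `d ≤ 2t`, point size `‖x‖ ≤ 4t`, scale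
`ε = (max 1 d)⁻¹`): every tame quantity is `≤ (constant) · (1/t)` or `≤ (constant)/(c t)^{3/4+σ}`,
with constants depending only on the fixed data. Kept separate so that the estimates files stay within
the heartbeat budget (small contexts for `nlinarith`). [folklore]
-/

noncomputable section

-- `Summit.<S>.<S>.…` (single-problem summit, D-0017) trips core's duplicate-namespace linter.
set_option linter.dupNamespace false

namespace Summit.FinalStateConjecture.FinalStateConjecture.Theorems

namespace OneHole

/-- `ε Δ ≤ 1/(1 − v)` for the scale `ε = (max 1 d)⁻¹` and a retardation `(1 − v)Δ ≤ d`. [folklore] -/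
theorem scale_mul_retardation_le {v d Δ : ℝ} (hv : v < 1) (hΔ : (1 - v) * Δ ≤ d) :
    (max 1 d)⁻¹ * Δ ≤ 1 / (1 - v) := by
  have h1v : 0 < 1 - v := by linarith
  have hm : 0 < max 1 d := lt_of_lt_of_le one_pos (le_max_left _ _)
  rw [inv_mul_le_iff₀ hm, mul_one_div, le_div_iff₀ h1v]
  calc Δ * (1 - v) = (1 - v) * Δ := mul_comm _ _
    _ ≤ d := hΔ
    _ ≤ max 1 d := le_max_right _ _

/-- **The frame-rate bookkeeping.** With `η = C/U²`, `c t ≤ U`, `t ≥ 1`: `η ≤ (C/c²)(1/t)·(1/t)` and the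
three tame quantities are `≤ (constant)(1/t)`:
`η(Δ + 12D³) ≤ (C/c²)(2/(1−v) + 12D³)/t`, `η · ε(Δ + 12D³) · (n + 8) ≤ 12 (C/c²) C_Δ / t` for
`n ≤ 4t`, and `4η(2t + 1 + A) ε(Δ + 12D³) ≤ 4(C/c²)(3 + A) C_Δ / t`, where `C_Δ = 1/(1−v) + 12D³`.
[folklore] -/
theorem tame_rates {C c v D t U Δ d n A : ℝ} (hC : 0 ≤ C) (hc : 0 < c) (hv : v < 1)
    (hD : 1 ≤ D) (ht : 1 ≤ t) (hU : c * t ≤ U) (hΔ0 : 0 ≤ Δ) (hΔ : (1 - v) * Δ ≤ d) (hd : d ≤ 2 * t)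
    (hn0 : 0 ≤ n) (hn : n ≤ 4 * t) (hA : 0 ≤ A) :
    C / U ^ 2 * (Δ + 12 * D ^ 3) ≤ C / c ^ 2 * (2 / (1 - v) + 12 * D ^ 3) * (1 / t) ∧
    (max 1 d)⁻¹ * (C / U ^ 2 * (Δ + 12 * D ^ 3) * n + 8 * (C / U ^ 2 * (Δ + 12 * D ^ 3)) +
      4 * (C / U ^ 2) * (2 * t + 1 + A) * (Δ + 12 * D ^ 3)) ≤
      C / c ^ 2 * (1 / (1 - v) + 12 * D ^ 3) * (12 + 4 * (3 + A)) * (1 / t) := by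
  have h1v : 0 < 1 - v := by linarith
  have ht0 : 0 < t := by linarith
  have hct : 0 < c * t := by positivity
  have hU0 : 0 < U := hct.trans_le hU
  have hD3 : 1 ≤ D ^ 3 := one_le_pow₀ hD
  have hm1 : 1 ≤ max 1 d := le_max_left _ _
  have hm0 : 0 < max 1 d := by linarith
  set ε : ℝ := (max 1 d)⁻¹ with hε
  have hε0 : 0 < ε := inv_pos.mpr hm0
  have hε1 : ε ≤ 1 := inv_le_one_of_one_le₀ hm1
  -- `η ≤ C/(c² t²)`
  have hη : C / U ^ 2 ≤ C / c ^ 2 * (1 / t) * (1 / t) := by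
    rw [show C / c ^ 2 * (1 / t) * (1 / t) = C / (c * t) ^ 2 by field_simp]
    exact div_le_div_of_nonneg_left hC (by positivity) (pow_le_pow_left₀ hct.le hU 2)
  have hη0 : 0 ≤ C / U ^ 2 := by positivity
  -- `Δ ≤ 2t/(1-v)`
  have hΔt : Δ ≤ 2 / (1 - v) * t := by
    rw [div_mul_eq_mul_div, le_div_iff₀ h1v]; nlinarith
  -- `ε (Δ + 12 D³) ≤ C_Δ`
  have hεΔ : ε * (Δ + 12 * D ^ 3) ≤ 1 / (1 - v) + 12 * D ^ 3 := by
    have h1 := scale_mul_retardation_le hv hΔ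
    have h2 : ε * (12 * D ^ 3) ≤ 12 * D ^ 3 := mul_le_of_le_one_left (by positivity) hε1
    rw [mul_add]; exact add_le_add h1 h2
  constructor
  · calc C / U ^ 2 * (Δ + 12 * D ^ 3) ≤ C / c ^ 2 * (1 / t) * (1 / t) * (2 / (1 - v) * t + 12 * D ^ 3 * t) := by
          refine mul_le_mul hη ?_ (by positivity) (by positivity)
          nlinarith
      _ = C / c ^ 2 * (2 / (1 - v) + 12 * D ^ 3) * (1 / t) := by field_simp
  · -- regroup: ε η (Δ + 12D³)(n + 8) + 4 η (2t+1+A) ε (Δ + 12 D³)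
    have hre : ε * (C / U ^ 2 * (Δ + 12 * D ^ 3) * n + 8 * (C / U ^ 2 * (Δ + 12 * D ^ 3)) +
        4 * (C / U ^ 2) * (2 * t + 1 + A) * (Δ + 12 * D ^ 3)) =
        C / U ^ 2 * (ε * (Δ + 12 * D ^ 3)) * ((n + 8) + 4 * (2 * t + 1 + A)) := by ring
    rw [hre]
    have hsz : (n + 8) + 4 * (2 * t + 1 + A) ≤ (12 + 4 * (3 + A)) * t := by nlinarith
    calc C / U ^ 2 * (ε * (Δ + 12 * D ^ 3)) * ((n + 8) + 4 * (2 * t + 1 + A))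
        ≤ (C / c ^ 2 * (1 / t) * (1 / t)) * (1 / (1 - v) + 12 * D ^ 3) * ((12 + 4 * (3 + A)) * t) := by
          refine mul_le_mul (mul_le_mul hη hεΔ (by positivity) (by positivity)) hsz (by positivity)
            (by positivity)
      _ = C / c ^ 2 * (1 / (1 - v) + 12 * D ^ 3) * (12 + 4 * (3 + A)) * (1 / t) := by field_simp

/-- **The uniform sizes of the parameter maps.** `η ‖x‖ ≤ 4C/c²` and `η (|U| + ‖ξ U‖ + 1 + A) ≤ (C/c²)(3 + A)`
for `η = C/U²`, `c t ≤ U ≤ t`, `t ≥ 1`, `‖x‖ ≤ 4t`, `0 ≤ U`, `‖ξ U‖ ≤ t`. [folklore] -/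
theorem tame_param_sizes {C c t U n m A : ℝ} (hC : 0 ≤ C) (hc : 0 < c) (ht : 1 ≤ t) (hU : c * t ≤ U)
    (hUt : U ≤ t) (hn0 : 0 ≤ n) (hn : n ≤ 4 * t) (hm0 : 0 ≤ m) (hm : m ≤ t) (hA : 0 ≤ A) :
    C / U ^ 2 * n ≤ 4 * (C / c ^ 2) ∧ C / U ^ 2 * (|U| + m + 1 + A) ≤ C / c ^ 2 * (3 + A) := by
  have ht0 : 0 < t := by linarith
  have hct : 0 < c * t := by positivity
  have hU0 : 0 < U := hct.trans_le hU
  have hη : C / U ^ 2 ≤ C / c ^ 2 * (1 / t) * (1 / t) := by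
    rw [show C / c ^ 2 * (1 / t) * (1 / t) = C / (c * t) ^ 2 by field_simp]
    exact div_le_div_of_nonneg_left hC (by positivity) (pow_le_pow_left₀ hct.le hU 2)
  have hη0 : 0 ≤ C / U ^ 2 := by positivity
  constructor
  · calc C / U ^ 2 * n ≤ C / c ^ 2 * (1 / t) * (1 / t) * (4 * t) :=
          mul_le_mul hη hn hn0 (by positivity)
      _ = 4 * (C / c ^ 2) * (1 / t) := by field_simp
      _ ≤ 4 * (C / c ^ 2) * 1 := by
          refine mul_le_mul_of_nonneg_left ?_ (by positivity)
          rw [div_le_one ht0]; exact ht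
      _ = _ := mul_one _
  · rw [abs_of_pos hU0]
    calc C / U ^ 2 * (U + m + 1 + A) ≤ C / c ^ 2 * (1 / t) * (1 / t) * ((3 + A) * t) :=
          mul_le_mul hη (by nlinarith) (by positivity) (by positivity)
      _ = C / c ^ 2 * (3 + A) * (1 / t) := by field_simp
      _ ≤ C / c ^ 2 * (3 + A) * 1 := by
          refine mul_le_mul_of_nonneg_left ?_ (by positivity)
          rw [div_le_one ht0]; exact ht
      _ = _ := mul_one _

/-- **Relative smallness of the rest-frame position difference.** With `η = C/U²` and a lower bound
`d_min ≤ d`, `d_min > 0`: `η(Δ + 12D³)(n + 4(2t + 1 + A)) ≤ (Θ₁/t) d` where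
`Θ₁ = (C/c²)(16 + 4A)(1/(1−v) + 12D³/d_min)`. [folklore] -/
theorem tame_relative {C c v D t U Δ d n A dmin : ℝ} (hC : 0 ≤ C) (hc : 0 < c) (hv : v < 1)
    (hD : 1 ≤ D) (ht : 1 ≤ t) (hU : c * t ≤ U) (hΔ0 : 0 ≤ Δ) (hΔ : (1 - v) * Δ ≤ d)
    (hn0 : 0 ≤ n) (hn : n ≤ 4 * t) (hA : 0 ≤ A) (hdmin : 0 < dmin) (hdm : dmin ≤ d) :
    C / U ^ 2 * (Δ + 12 * D ^ 3) * (n + 4 * (2 * t + 1 + A)) ≤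
      C / c ^ 2 * (16 + 4 * A) * (1 / (1 - v) + 12 * D ^ 3 / dmin) * (1 / t) * d := by
  have h1v : 0 < 1 - v := by linarith
  have ht0 : 0 < t := by linarith
  have hct : 0 < c * t := by positivity
  have hU0 : 0 < U := hct.trans_le hU
  have hd0 : 0 < d := hdmin.trans_le hdm
  have hη : C / U ^ 2 ≤ C / c ^ 2 * (1 / t) * (1 / t) := by
    rw [show C / c ^ 2 * (1 / t) * (1 / t) = C / (c * t) ^ 2 by field_simp]
    exact div_le_div_of_nonneg_left hC (by positivity) (pow_le_pow_left₀ hct.le hU 2)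
  have hΔd : Δ ≤ 1 / (1 - v) * d := by rw [div_mul_eq_mul_div, le_div_iff₀ h1v]; linarith
  have hDd : 12 * D ^ 3 ≤ 12 * D ^ 3 / dmin * d := by
    rw [div_mul_eq_mul_div, le_div_iff₀ hdmin]
    exact mul_le_mul_of_nonneg_left hdm (by positivity)
  have hsum : Δ + 12 * D ^ 3 ≤ (1 / (1 - v) + 12 * D ^ 3 / dmin) * d := by linarith
  have hsz : n + 4 * (2 * t + 1 + A) ≤ (16 + 4 * A) * t := by nlinarith
  calc C / U ^ 2 * (Δ + 12 * D ^ 3) * (n + 4 * (2 * t + 1 + A))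
      ≤ (C / c ^ 2 * (1 / t) * (1 / t)) * ((1 / (1 - v) + 12 * D ^ 3 / dmin) * d) * ((16 + 4 * A) * t) := by
        refine mul_le_mul (mul_le_mul hη hsum (by positivity) (by positivity)) hsz (by positivity)
          (by positivity)
    _ = C / c ^ 2 * (16 + 4 * A) * (1 / (1 - v) + 12 * D ^ 3 / dmin) * (1 / t) * d := by field_simp

/-- The mass rate on the clock: `A/U^{3/4+σ} ≤ A/(c t)^{3/4+σ}` for `c t ≤ U`, `0 < c t`, `σ > 0`.
[folklore] -/
theorem mass_rate_le {A c t U σ : ℝ} (hA : 0 ≤ A) (hct : 0 < c * t) (hU : c * t ≤ U) (hσ : 0 < σ) :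
    A / U ^ ((3 : ℝ) / 4 + σ) ≤ A / (c * t) ^ ((3 : ℝ) / 4 + σ) :=
  div_le_div_of_nonneg_left hA (Real.rpow_pos_of_pos hct _)
    (Real.rpow_le_rpow hct.le hU (by positivity))

end OneHole

/-- Registered sub-goal form (stub `oneHole_mass_rate_le` of the crux item) of `OneHole.mass_rate_le`:
the monopole mass rate read on the retarded clock, `A/U^{3/4+σ} ≤ A/(c t)^{3/4+σ}` for `U ≥ c t`.
[folklore] -/
theorem oneHole_mass_rate_le : ∀ {A c t U σ : ℝ}, 0 ≤ A → 0 < c * t → c * t ≤ U → 0 < σ → A / U ^ ((3 : ℝ) / 4 + σ) ≤ A / (c * t) ^ ((3 : ℝ) / 4 + σ) :=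
  fun hA hct hU hσ ↦ OneHole.mass_rate_le hA hct hU hσ

end Summit.FinalStateConjecture.FinalStateConjecture.Theorems

end
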